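import Literature.AlgebraicGeometry.HodgeTheory.QuaternionicQuarticCover
import Mathlib.RingTheory.MvPolynomial.IrreducibleQuadratic
import HarnessLib

/-!
# The universal quaternionic quartic specialises to a PRIME form at every injective point `A ↪ L`

Layer `Literature/AlgebraicGeometry/HodgeTheory`. Theorems (plus plumbing definitions: the coefficient indices
`linIdx`/`linIdxEquiv`/`psiIdx`, the witness points `wit₁`, `wit₂`, the indicator specialisation `κInd`, and the
abbreviations `aLin`, `univC`, `univΨ`); no named fact. Written by the prover seat `hodge-nonav-19716-p2` (g13, cell
`hodge-nonav`) for brick **QF-1b «COVER»** (clause (C2), algebraic half) of prover-Bx's programme Q-FAMILY (memo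
`PROGRAMME-Q-FAMILY-Bx-g18.md` §6–§7; route `HodgeConjecture/Q8SymplecticPowers`, crux K1Q, stmt-HodgeConjecture-24190):
the discharge of the eight side conditions of QF-1a `irreducible_quarticShape` for the universal pair, announced in
that file's docstring («each is witnessed by a point of `L³` through `not_dvd_of_eval_ne_zero`»).

With `A = ParamRing e = ℂ[a_i | i ∈ CIdx e]`, `Q_e = univQ e` (`QuaternionicQuarticCover`):

* the linear form: `cOfR_eq_sum` (`c = a₀x₀ + a₁x₁ + a₂x₂`, via `linIdxEquiv : Fin 3 ≃ DegIndex 1 1`), `eval_cOfR`,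
  `eval_rename_swap_cOfR`, `coeff_linIdx_cOfR`, `prime_cOfR` (a non-zero linear form over a field is prime —
  Mathlib `irreducible_of_totalDegree_eq_one`); `ψOfR_of_indicator` (`ψ = x₀^{e−1} + x₁^{e−1}` for the indicator
  coefficient vector);
* `apply_eval_eq_eval_map`, `not_map_dvd_map_of_witness` — `φq ∤ φp` in `L[x]` from a point `w ∈ A³` with
  `q(w) = 0` and `φ(p(w)) ≠ 0`;
* the witnesses `w₁ = (a₂, 0, −a₀)` (a zero of `ĉ`) and `w₂ = (1, 0, 0)` (a zero of `x₂`) with their values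
  `x₂(w₁) = −a₀`, `σĉ(w₁) = a₂(a₁ − a₀)`, `(x₀ − x₁)(w₁) = a₂`, `ĉ(w₂) = a₀`, `σĉ(w₂) = a₁` (all non-zero in the
  domain `A`) and `ψ̂(w₁) ≠ 0`, `ψ̂(w₂) ≠ 0` (under the indicator specialisation `κInd : b_d ↦ [d = x₀^{e−1}]` they
  become `a₂^{e−1}` and `1`; `e ≥ 2`);
* `genericityElem e = a₀ a₁ a₂ (a₁ − a₀) ψ̂(w₁) ψ̂(w₂) ∈ A` (non-zero for `e ≥ 2`, `genericityElem_ne_zero`) and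
  **`irreducible_quarticFormR_of_genericity`**, **`prime_map_univQ_of_genericity`**: at every field-valued point
  `φ : A → L` with `φ(G_e) ≠ 0`, `φ(Q_e) = quarticFormR e (cOfR (φ ∘ X)) (ψOfR (φ ∘ X))` is irreducible, hence prime —
  the explicit open `D(G_e)` of good parameters; **`…_of_injective`**: in particular at every INJECTIVE `φ` (`e ≥ 2`),
  e.g. the generic point `A ↪ Frac A` and all its field extensions.

Honest scope: elementary commutative algebra for one explicit family; nothing here bears on HC.

## References

* [Lang2002] S. Lang, Algebra, 3rd ed. (2002), Ch. IV §1 (polynomial rings, evaluation), §3 Thm. 3.1 (Eisenstein).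
* [Hartshorne1977] R. Hartshorne, Algebraic Geometry (1977), I §2 (graded polynomial rings).
* [Kollar2007] J. Kollár, Lectures on Resolution of Singularities (2007), §3.3 (the family's equation).
-/

noncomputable section

open CategoryTheory AlgebraicGeometry MvPolynomial Limits TopologicalSpace TensorProduct
open Literature.AlgebraicGeometry.Motives Literature.AlgebraicGeometry.Motives.UniversalHypersurface

universe u

namespace Literature.AlgebraicGeometry.HodgeTheory.Q8Family

/-! ### The linear form `c`: the three coefficient indices -/

section LinearForm

variable {e : ℕ}

/-- The index `x_j ∈ DegIndex 1 1` of the linear monomial `x_j`. [folklore] -/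
def linIdx (j : Fin 3) : DegIndex 1 1 := ⟨Finsupp.single j 1, Finsupp.degree_single j 1⟩

/-- Every exponent of degree `1` in three variables is a variable `x_j`. [cite: Hartshorne1977, I §2 (p. 9, the grading of S = k[x₀,…,xₙ])] -/
theorem exists_linIdx_eq (d : DegIndex 1 1) : ∃ j, d = linIdx j := by
  obtain ⟨m, hm⟩ := d
  have hsum : m 0 + m 1 + m 2 = 1 := by
    have h := hm
    rw [Finsupp.degree_eq_sum, Fin.sum_univ_three] at h
    exact h
  have key : ∃ j : Fin 3, m = Finsupp.single j 1 := by
    by_cases h0 : m 0 = 1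
    · refine ⟨0, Finsupp.ext fun i => ?_⟩
      fin_cases i <;> simp <;> omega
    by_cases h1 : m 1 = 1
    · refine ⟨1, Finsupp.ext fun i => ?_⟩
      fin_cases i <;> simp <;> omega
    · refine ⟨2, Finsupp.ext fun i => ?_⟩
      fin_cases i <;> simp <;> omega
  obtain ⟨j, hj⟩ := key
  exact ⟨j, Subtype.ext hj⟩

/-- `linIdx` is injective. [cite: Hartshorne1977, I §2 (p. 9, the grading of S = k[x₀,…,xₙ])] -/
theorem linIdx_injective : Function.Injective (linIdx) := by
  intro i j h
  have h1 : (Finsupp.single i 1 : Fin 3 →₀ ℕ) = Finsupp.single j 1 := congrArg Subtype.val h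
  exact Finsupp.single_left_injective one_ne_zero h1

/-- The three linear exponents: `Fin 3 ≃ DegIndex 1 1`. [folklore] -/
def linIdxEquiv : Fin 3 ≃ DegIndex 1 1 :=
  Equiv.ofBijective linIdx ⟨linIdx_injective, fun d => by
    obtain ⟨j, rfl⟩ := exists_linIdx_eq d
    exact ⟨j, rfl⟩⟩

/-- **`c = a₀ x₀ + a₁ x₁ + a₂ x₂`**: the linear form of a coefficient vector written in the variables.
[cite: Kollar2007, §3.3] -/
theorem cOfR_eq_sum {R : Type u} [CommRing R] (a : CIdx e → R) :
    cOfR a = ∑ j : Fin 3, C (a (Sum.inl (linIdx j))) * X j := by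
  rw [cOfR, ← Equiv.sum_comp linIdxEquiv]
  refine Finset.sum_congr rfl fun j _ => ?_
  rw [C_mul_X_eq_monomial]
  rfl

/-- **Evaluating the linear form**: `c(z) = a₀ z₀ + a₁ z₁ + a₂ z₂`. [cite: Kollar2007, §3.3] -/
theorem eval_cOfR {R : Type u} [CommRing R] (a : CIdx e → R) (z : Fin 3 → R) :
    eval z (cOfR a) =
      a (Sum.inl (linIdx 0)) * z 0 + a (Sum.inl (linIdx 1)) * z 1 + a (Sum.inl (linIdx 2)) * z 2 := by
  rw [cOfR_eq_sum, map_sum, Fin.sum_univ_three]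
  simp only [map_mul, eval_C, eval_X]

/-- Evaluating `σc` (`σ` the swap of `x₀, x₁`): `σc(z) = a₀ z₁ + a₁ z₀ + a₂ z₂`. [cite: Kollar2007, §3.3] -/
theorem eval_rename_swap_cOfR {R : Type u} [CommRing R] (a : CIdx e → R) (z : Fin 3 → R) :
    eval z (rename (Equiv.swap (0 : Fin 3) 1) (cOfR a)) =
      a (Sum.inl (linIdx 0)) * z 1 + a (Sum.inl (linIdx 1)) * z 0 + a (Sum.inl (linIdx 2)) * z 2 := by
  rw [eval_rename, eval_cOfR]
  simp [Equiv.swap_apply_of_ne_of_ne]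

/-- The coefficient of `x_j` in `c` is `a_j`. [cite: Kollar2007, §3.3] -/
theorem coeff_linIdx_cOfR {R : Type u} [CommRing R] (a : CIdx e → R) (j : Fin 3) :
    coeff (linIdx j).1 (cOfR a) = a (Sum.inl (linIdx j)) := by
  classical
  rw [cOfR, coeff_sum]
  simp only [coeff_monomial]
  rw [Finset.sum_eq_single (linIdx j) (fun b _ hb => if_neg fun h => hb (Subtype.ext h))
    (fun h => absurd (Finset.mem_univ _) h), if_pos rfl]

/-- **A nonzero linear form over a field is prime** (`totalDegree = 1`, Mathlib
`irreducible_of_totalDegree_eq_one`; `L[x₀,x₁,x₂]` is factorial). [cite: Lang2002, Ch. IV §1 (degree of a product over an integral domain)] -/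
theorem prime_cOfR {L : Type u} [Field L] (a : CIdx e → L) (j : Fin 3) (hj : a (Sum.inl (linIdx j)) ≠ 0) :
    Prime (cOfR a) := by
  have hne : cOfR a ≠ 0 := by
    intro h
    have := coeff_linIdx_cOfR a j
    rw [h, coeff_zero] at this
    exact hj this.symm
  have hdeg : (cOfR a).totalDegree = 1 := (isHomogeneous_cOfR a).totalDegree hne
  refine (irreducible_of_totalDegree_eq_one hdeg fun x hx => ?_).prime
  have hdvd := hx (linIdx j).1
  rw [coeff_linIdx_cOfR] at hdvd
  exact isUnit_iff_ne_zero.mpr fun hx0 => hj (zero_dvd_iff.mp (hx0 ▸ hdvd))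

end LinearForm

/-! ### The form `ψ = ψ₀ + σ^*ψ₀` with a single coefficient -/

section PsiForm

variable {e : ℕ}

/-- The exponent `x₀^{e−1} ∈ DegIndex 1 (e − 1)`. [folklore] -/
def psiIdx (e : ℕ) : DegIndex 1 (e - 1) :=
  ⟨Finsupp.single 0 (e - 1), Finsupp.degree_single 0 (e - 1)⟩

/-- For a coefficient vector whose `ψ`-part is the indicator of `x₀^{e−1}`, `ψ = x₀^{e−1} + x₁^{e−1}`.
[cite: Kollar2007, §3.3] -/
theorem ψOfR_of_indicator {R : Type u} [CommRing R] (a : CIdx e → R)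
    (ha : ∀ d : DegIndex 1 (e - 1), a (Sum.inr d) = if d = psiIdx e then 1 else 0) :
    ψOfR a = X 0 ^ (e - 1) + X 1 ^ (e - 1) := by
  classical
  have hsum : (∑ d : DegIndex 1 (e - 1), monomial d.1 (a (Sum.inr d)) : MvPolynomial (Fin 3) R) =
      monomial (Finsupp.single 0 (e - 1)) 1 := by
    rw [Finset.sum_eq_single (psiIdx e) (fun b _ hb => by rw [ha b, if_neg hb, monomial_zero])
      (fun h => absurd (Finset.mem_univ _) h), ha, if_pos rfl]
    rfl
  rw [ψOfR, hsum, rename_monomial, Finsupp.mapDomain_single, Equiv.swap_apply_left, X_pow_eq_monomial,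
    X_pow_eq_monomial]

end PsiForm

/-! ### Non-divisibility in `L[x₀,x₁,x₂]` from `A`-valued witnesses -/

section Transfer

variable {A : Type u} [CommRing A] {L : Type u} [CommRing L] {σ : Type*}

/-- Evaluation commutes with a change of coefficients: `φ(p(w)) = (φp)(φ ∘ w)`.
[cite: Lang2002, Ch. IV §1 (evaluation homomorphism)] -/
theorem apply_eval_eq_eval_map (φ : A →+* L) (w : σ → A) (p : MvPolynomial σ A) :
    φ (eval w p) = eval (φ ∘ w) (map φ p) := by
  rw [eval_map, show eval w p = eval₂ (RingHom.id A) w p from rfl, eval₂_comp_left, RingHom.comp_id]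

/-- **Non-divisibility from an `A`-valued witness**: if `q(w) = 0` and `φ(p(w)) ≠ 0` for some `w ∈ A^σ`, then
`φq ∤ φp` in `L[x]` (the zero `φ ∘ w` of `φq` is not a zero of `φp`; `not_dvd_of_eval_ne_zero`).
[cite: Lang2002, Ch. IV §1 (evaluation homomorphism)] -/
theorem not_map_dvd_map_of_witness {L : Type u} [Field L] (φ : A →+* L) {q p : MvPolynomial σ A} (w : σ → A)
    (hq : eval w q = 0) (hp : φ (eval w p) ≠ 0) : ¬ map φ q ∣ map φ p :=
  not_dvd_of_eval_ne_zero (φ ∘ w) (by rw [← apply_eval_eq_eval_map, hq, map_zero])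
    (by rwa [← apply_eval_eq_eval_map])

end Transfer

/-! ### The side conditions of `irreducible_quarticShape` at an injective point `φ : A ↪ L` -/

section SideConditions

variable (e : ℕ)

/-- The coordinate function `a_j ∈ A` of the linear part (`j = 0, 1, 2`). [folklore] -/
abbrev aLin (j : Fin 3) : ParamRing e := X (Sum.inl (linIdx j))

/-- The universal linear form `ĉ = a₀ x₀ + a₁ x₁ + a₂ x₂ ∈ A[x₀,x₁,x₂]`. [folklore] -/
abbrev univC : MvPolynomial (Fin 3) (ParamRing e) := cOfR fun i => (X i : ParamRing e)

/-- The universal form `ψ̂ = ψ₀ + σ^*ψ₀ ∈ A[x₀,x₁,x₂]`. [folklore] -/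
abbrev univΨ : MvPolynomial (Fin 3) (ParamRing e) := ψOfR fun i => (X i : ParamRing e)

/-- The witness point `w₁ = (a₂, 0, −a₀) ∈ A³`, a zero of `ĉ`. [folklore] -/
def wit₁ : Fin 3 → ParamRing e := ![aLin e 2, 0, -aLin e 0]

/-- The witness point `w₂ = (1, 0, 0) ∈ A³`, a zero of `x₂`. [folklore] -/
def wit₂ : Fin 3 → ParamRing e := ![1, 0, 0]

/-- `w₁ 0 = a₂` (`rfl`). [cite: Kollar2007, §3.3] -/
@[simp] theorem wit₁_zero : wit₁ e 0 = aLin e 2 := rfl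
/-- `w₁ 1 = 0` (`rfl`). [cite: Kollar2007, §3.3] -/
@[simp] theorem wit₁_one : wit₁ e 1 = 0 := rfl
/-- `w₁ 2 = −a₀` (`rfl`). [cite: Kollar2007, §3.3] -/
@[simp] theorem wit₁_two : wit₁ e 2 = -aLin e 0 := rfl
/-- `w₂ 0 = 1` (`rfl`). [cite: Kollar2007, §3.3] -/
@[simp] theorem wit₂_zero : wit₂ e 0 = 1 := rfl
/-- `w₂ 1 = 0` (`rfl`). [cite: Kollar2007, §3.3] -/
@[simp] theorem wit₂_one : wit₂ e 1 = 0 := rfl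
/-- `w₂ 2 = 0` (`rfl`). [cite: Kollar2007, §3.3] -/
@[simp] theorem wit₂_two : wit₂ e 2 = 0 := rfl

/-- `ĉ(w₁) = a₀a₂ − a₂a₀ = 0`. [cite: Kollar2007, §3.3] -/
theorem eval_wit₁_univC : eval (wit₁ e) (univC e) = 0 := by
  rw [eval_cOfR]; simp; ring

/-- `x₂(w₁) = −a₀`. [cite: Kollar2007, §3.3] -/
theorem eval_wit₁_X_two : eval (wit₁ e) (X 2 : MvPolynomial (Fin 3) (ParamRing e)) = -aLin e 0 := by
  simp

/-- `σĉ(w₁) = a₂ (a₁ − a₀)`. [cite: Kollar2007, §3.3] -/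
theorem eval_wit₁_rename_univC :
    eval (wit₁ e) (rename (Equiv.swap (0 : Fin 3) 1) (univC e)) = aLin e 2 * (aLin e 1 - aLin e 0) := by
  rw [eval_rename_swap_cOfR]; simp; ring

/-- `(x₀ − x₁)(w₁) = a₂`. [cite: Kollar2007, §3.3] -/
theorem eval_wit₁_X_sub : eval (wit₁ e) (X 0 - X 1 : MvPolynomial (Fin 3) (ParamRing e)) = aLin e 2 := by
  simp

/-- `x₂(w₂) = 0`. [cite: Kollar2007, §3.3] -/
theorem eval_wit₂_X_two : eval (wit₂ e) (X 2 : MvPolynomial (Fin 3) (ParamRing e)) = 0 := by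
  simp

/-- `ĉ(w₂) = a₀`. [cite: Kollar2007, §3.3] -/
theorem eval_wit₂_univC : eval (wit₂ e) (univC e) = aLin e 0 := by
  rw [eval_cOfR]; simp

/-- `σĉ(w₂) = a₁`. [cite: Kollar2007, §3.3] -/
theorem eval_wit₂_rename_univC : eval (wit₂ e) (rename (Equiv.swap (0 : Fin 3) 1) (univC e)) = aLin e 1 := by
  rw [eval_rename_swap_cOfR]; simp

/-- The coordinate functions `a_j` are non-zero elements of `A` (variables of a polynomial ring). [cite: Lang2002, Ch. IV §1 (polynomial rings: the variables are algebraically independent)] -/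
theorem aLin_ne_zero (j : Fin 3) : aLin e j ≠ 0 := X_ne_zero _

/-- `a₁ − a₀ ≠ 0` in `A` (distinct variables). [cite: Lang2002, Ch. IV §1 (polynomial rings: the variables are algebraically independent)] -/
theorem aLin_one_sub_aLin_zero_ne_zero : aLin e 1 - aLin e 0 ≠ 0 := by
  rw [sub_ne_zero]
  intro h
  have := linIdx_injective (Sum.inl_injective (X_injective h))
  exact absurd this (by decide)

/-- **The indicator specialisation** `κ : A → A`, `a_j ↦ a_j`, `b_d ↦ [d = x₀^{e−1}]`: an algebra
endomorphism used to show that the `ψ`-witness values are nonzero. [folklore] -/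
def κInd : ParamRing e →ₐ[ℂ] ParamRing e :=
  aeval fun i => Sum.elim (fun d => (X (Sum.inl d) : ParamRing e)) (fun d => if d = psiIdx e then 1 else 0) i

/-- `κ(ψ̂) = x₀^{e−1} + x₁^{e−1}`. [cite: Kollar2007, §3.3] -/
theorem map_κInd_univΨ : map (κInd e : ParamRing e →+* ParamRing e) (univΨ e) = X 0 ^ (e - 1) + X 1 ^ (e - 1) := by
  rw [map_ψOfR]
  refine ψOfR_of_indicator _ fun d => ?_
  simp [κInd]

/-- `κ(a_j) = a_j`. [cite: Lang2002, Ch. IV §1 (evaluation homomorphism)] -/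
@[simp] theorem κInd_aLin (j : Fin 3) : κInd e (aLin e j) = aLin e j := by
  simp [κInd, aLin]

/-- `ψ̂(w₁) ≠ 0`: under `κ` it becomes `(x₀^{e−1} + x₁^{e−1})(a₂, 0, −a₀) = a₂^{e−1}` (`e ≥ 2`).
[cite: Kollar2007, §3.3] -/
theorem eval_wit₁_univΨ_ne_zero (he : 2 ≤ e) : eval (wit₁ e) (univΨ e) ≠ 0 := by
  intro h
  have h2 := apply_eval_eq_eval_map (κInd e : ParamRing e →+* ParamRing e) (wit₁ e) (univΨ e)
  rw [h, map_zero, map_κInd_univΨ] at h2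
  have h3 : (0 : ParamRing e) = aLin e 2 ^ (e - 1) := by
    rw [h2]; simp [zero_pow (by omega : e - 1 ≠ 0)]
  exact pow_ne_zero _ (aLin_ne_zero e 2) h3.symm

/-- `ψ̂(w₂) ≠ 0`: under `κ` it becomes `(x₀^{e−1} + x₁^{e−1})(1, 0, 0) = 1` (`e ≥ 2`). [cite: Kollar2007, §3.3] -/
theorem eval_wit₂_univΨ_ne_zero (he : 2 ≤ e) : eval (wit₂ e) (univΨ e) ≠ 0 := by
  intro h
  have h2 := apply_eval_eq_eval_map (κInd e : ParamRing e →+* ParamRing e) (wit₂ e) (univΨ e)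
  rw [h, map_zero, map_κInd_univΨ] at h2
  have h3 : (0 : ParamRing e) = 1 := by
    rw [h2]; simp [zero_pow (by omega : e - 1 ≠ 0)]
  exact zero_ne_one h3

/-- **The genericity element `G_e ∈ A`**: the product `a₀ a₁ a₂ (a₁ − a₀) ψ̂(w₁) ψ̂(w₂)` of the witness values;
the side conditions of `irreducible_quarticShape` hold at every field-valued point `φ` with `φ(G_e) ≠ 0` — the
explicit Zariski-open `D(G_e)` of the parameter space over which the fibres of the cover are irreducible
(prover-Bx's `G_e` of clause (C3)). [cite: Kollar2007, §3.3] -/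
def genericityElem : ParamRing e :=
  aLin e 0 * aLin e 1 * aLin e 2 * (aLin e 1 - aLin e 0) * eval (wit₁ e) (univΨ e) * eval (wit₂ e) (univΨ e)

/-- `G_e ≠ 0` (`e ≥ 2`; `A` is a domain). [cite: Lang2002, Ch. IV §1 (polynomial rings over a domain are domains)] -/
theorem genericityElem_ne_zero (he : 2 ≤ e) : genericityElem e ≠ 0 :=
  mul_ne_zero (mul_ne_zero (mul_ne_zero (mul_ne_zero (mul_ne_zero (aLin_ne_zero e 0) (aLin_ne_zero e 1))
    (aLin_ne_zero e 2)) (aLin_one_sub_aLin_zero_ne_zero e)) (eval_wit₁_univΨ_ne_zero e he))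
    (eval_wit₂_univΨ_ne_zero e he)

variable {e} {L : Type} [Field L] (φ : ParamRing e →+* L)

/-- The specialised linear form is `φ(ĉ)`. [cite: Lang2002, Ch. IV §1 (functoriality of polynomial rings in the coefficients)] -/
theorem cOfR_apply_eq_map : cOfR (fun i => φ (X i)) = map φ (univC e) := (map_cOfR φ _).symm

/-- The specialised `ψ` is `φ(ψ̂)`. [cite: Lang2002, Ch. IV §1 (functoriality of polynomial rings in the coefficients)] -/
theorem ψOfR_apply_eq_map : ψOfR (fun i => φ (X i)) = map φ (univΨ e) := (map_ψOfR φ _).symm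

/-- **The eight side conditions of `irreducible_quarticShape` hold at every point `φ : A → L` of `D(G_e)`**,
hence the specialised quaternionic quartic form is irreducible there. [cite: Lang2002, Ch. IV §3 Thm. 3.1] -/
theorem irreducible_quarticFormR_of_genericity (hG : φ (genericityElem e) ≠ 0) :
    Irreducible (quarticFormR e (cOfR fun i => φ (X i)) (ψOfR fun i => φ (X i))) := by
  rw [genericityElem, map_mul, map_mul, map_mul, map_mul, map_mul] at hG
  simp only [mul_ne_zero_iff] at hG
  obtain ⟨⟨⟨⟨⟨h0, h1⟩, h2⟩, h10⟩, hψ1⟩, hψ2⟩ := hG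
  have hX2 : (X 2 : MvPolynomial (Fin 3) L) = map φ (X 2) := (map_X φ 2).symm
  have hX01 : (X 0 - X 1 : MvPolynomial (Fin 3) L) = map φ (X 0 - X 1) := by rw [map_sub, map_X, map_X]
  have hσ : rename (Equiv.swap (0 : Fin 3) 1) (cOfR fun i => φ (X i)) =
      map φ (rename (Equiv.swap (0 : Fin 3) 1) (univC e)) := by rw [cOfR_apply_eq_map, map_rename]
  refine irreducible_quarticShape e (prime_cOfR _ 0 (by simpa using h0)) ?_ ?_ ?_ ?_ ?_ ?_ ?_
  · rw [cOfR_apply_eq_map, hX2]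
    exact not_map_dvd_map_of_witness φ (wit₁ e) (eval_wit₁_univC e)
      (by rw [eval_wit₁_X_two, map_neg]; exact neg_ne_zero.mpr h0)
  · rw [hσ, cOfR_apply_eq_map]
    exact not_map_dvd_map_of_witness φ (wit₁ e) (eval_wit₁_univC e)
      (by rw [eval_wit₁_rename_univC, map_mul]; exact mul_ne_zero h2 h10)
  · rw [cOfR_apply_eq_map, hX01]
    exact not_map_dvd_map_of_witness φ (wit₁ e) (eval_wit₁_univC e) (by rw [eval_wit₁_X_sub]; exact h2)
  · rw [cOfR_apply_eq_map, ψOfR_apply_eq_map]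
    exact not_map_dvd_map_of_witness φ (wit₁ e) (eval_wit₁_univC e) hψ1
  · rw [hX2, cOfR_apply_eq_map]
    exact not_map_dvd_map_of_witness φ (wit₂ e) (eval_wit₂_X_two e) (by rw [eval_wit₂_univC]; exact h0)
  · rw [hX2, hσ]
    exact not_map_dvd_map_of_witness φ (wit₂ e) (eval_wit₂_X_two e) (by rw [eval_wit₂_rename_univC]; exact h1)
  · rw [hX2, ψOfR_apply_eq_map]
    exact not_map_dvd_map_of_witness φ (wit₂ e) (eval_wit₂_X_two e) hψ2

/-- **The specialised universal quaternionic quartic `φ(Q_e)` is PRIME at every point of `D(G_e)`.**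
[cite: Lang2002, Ch. IV §3 Thm. 3.1] -/
theorem prime_map_univQ_of_genericity (hG : φ (genericityElem e) ≠ 0) : Prime (MvPolynomial.map φ (univQ e)) := by
  rw [map_univQ]
  exact (irreducible_quarticFormR_of_genericity φ hG).prime

/-- At an INJECTIVE point `φ : A ↪ L` (`e ≥ 2`) — e.g. the generic point `A ↪ Frac A` and its field
extensions — `φ(G_e) ≠ 0`, so the specialised form is irreducible. [cite: Lang2002, Ch. IV §3 Thm. 3.1] -/
theorem irreducible_quarticFormR_of_injective (hφ : Function.Injective φ) (he : 2 ≤ e) :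
    Irreducible (quarticFormR e (cOfR fun i => φ (X i)) (ψOfR fun i => φ (X i))) :=
  irreducible_quarticFormR_of_genericity φ ((map_ne_zero_iff φ hφ).mpr (genericityElem_ne_zero e he))

/-- **`φ(Q_e)` is prime at every injective point** `φ : A ↪ L` into a field (`e ≥ 2`). [cite: Lang2002, Ch. IV §3 Thm. 3.1] -/
theorem prime_map_univQ_of_injective (hφ : Function.Injective φ) (he : 2 ≤ e) :
    Prime (MvPolynomial.map φ (univQ e)) :=
  prime_map_univQ_of_genericity φ ((map_ne_zero_iff φ hφ).mpr (genericityElem_ne_zero e he))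

end SideConditions

end Literature.AlgebraicGeometry.HodgeTheory.Q8Family

end
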